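import Literature.Geometry.Kaehler.HolomorphicLineBundleCechBanach
import Literature.Geometry.Kaehler.HolomorphicLineBundleCechLeray
import Literature.Analysis.OperatorTheory.SchwartzFiniteness
import HarnessLib

/-!
# The Cartan–Serre finiteness theorem for `H¹(𝔘, 𝒪(L))` (twisted Cartan–Serre, II)

Layer `Literature/Geometry/Kaehler`. For a cocycle line bundle `L` on a COMPACT complex manifold `M`
and nested Leray data `D : DolbeaultLerayDatum E M` subordinate to the trivialisation of `L`
(`fr`, `hfr`, `HolomorphicLineBundleCechBanach`), the Čech cohomology `H¹(𝔘₀, 𝒪(L))` of the level-`0`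
cover with coefficients in the sheaf of sections of `L` is FINITE-DIMENSIONAL
(**`DolbeaultLerayDatum.finite_cohomology_oneL`**). H. Cartan, J.-P. Serre (1953); H. Grauert,
R. Remmert, *Theorie der Steinschen Räume* (1977), Kap. VI §4; O. Forster, *Lectures on Riemann
Surfaces* (1981), Thm. 14.9 — by L. Schwartz's method exactly as the tree's scalar
`finite_dolbeaultCohomology_holds`:

1. (`HolomorphicLineBundleCechBanach`) the Banach spaces of bounded holomorphic cochains of the four
   levels, restriction compact (Montel), `δ` bounded;
2. here: the bounded cocycles `ZbL` with the restricted operators `resZL` (compact), `deltaZL`, the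
   class map `clsL` into `H¹(𝔘₀, 𝒪(L))` killing coboundaries, and the two LERAY INPUTS from the
   degree-one Leray lemma `FramedCover.exists_cocycle_res_eq_add_delta` (the members of every level
   are `∂̄`-acyclic chart-convex sets): every class of level `0` is represented by a bounded cocycle
   restricted from level `1` (`exists_clsL_resZL_eq`), and the controlled solvability
   `res res x = res y + δ w` (`exists_resZL_resZL_eq_add_deltaZL`);
3. the abstract finiteness theorem `Module.finite_of_compact_restriction` (`SchwartzFiniteness`).

Everything is proved; the definitions are `ZbL`, `resZL`, `deltaZL`, `toCocycleL`, `clsL`.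

## References

* H. Cartan, J.-P. Serre, C. R. Acad. Sci. Paris 237 (1953) 128–130. [CartanSerre1953]
* H. Grauert, R. Remmert, *Theorie der Steinschen Räume* (1977), Kap. VI §4.3. [GrauertRemmert1977]
* O. Forster, *Lectures on Riemann Surfaces* (1981), Lemma 14.7, Thm. 14.9. [Forster1981]
-/

noncomputable section

open scoped Manifold ContDiff Topology
open Set Filter Function Metric Literature.NumberTheory.Transcendental Literature.Analysis.Complex
  Literature.Algebra.Homology Literature.Analysis.OperatorTheory

namespace Literature.Geometry.Kaehler

variable {ι : Type*} {E : Type*} [NormedAddCommGroup E] [NormedSpace ℂ E]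
  {M : Type*} [TopologicalSpace M] [ChartedSpace E M]

namespace HolomorphicLineBundle.FramedCover

variable {κ : Type*} {L : HolomorphicLineBundle ι E M} (C : L.FramedCover κ)

/-- **Shrinking twice is shrinking once** (restriction of cochains is transitive): for
`U'' ⊆ U' ⊆ C.U` the cochain spaces of `(C.shrink U').shrink U''` and `C.shrink U''` agree
definitionally, and `res U'' ∘ res U' = res U''`. [folklore] -/
theorem res_res {U' U'' : κ → Set M} (hU' : ∀ k, IsOpen (U' k)) (h' : ∀ k, U' k ⊆ C.U k)
    (hU'' : ∀ k, IsOpen (U'' k)) (h'' : ∀ k, U'' k ⊆ U' k) (a : ℕ) (c : C.Cochain a) :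
    (C.shrink U' hU' h').res U'' hU'' h'' a (C.res U' hU' h' a c) =
      C.res U'' hU'' (fun k ↦ (h'' k).trans (h' k)) a c := by
  funext J
  refine Subtype.ext (funext fun x ↦ ?_)
  by_cases hx : x ∈ cechSet U'' J
  · rw [(C.shrink U' hU' h').res_apply_apply_of_mem _ _ _ _ hx, C.res_apply_apply_of_mem _ _ _ _ hx,
      C.res_apply_apply_of_mem _ _ _ _ (cechSet_mono h'' J hx)]
  · rw [holFunOn.apply_of_notMem _ hx, holFunOn.apply_of_notMem _ hx]

end HolomorphicLineBundle.FramedCover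

namespace DolbeaultLerayDatum

variable (D : DolbeaultLerayDatum E M) {L : HolomorphicLineBundle ι E M} (fr : ↥D.s → ι)
  (hfr : ∀ i, D.U 3 i ⊆ L.baseSet (fr i))

/-! ### Algebraic restriction to a strictly lower level is bounded -/

/-- **A holomorphic cochain of level `l'` is bounded on a level `l < l'`** (its components are
continuous on the compact `closure U_{l,J} ⊆ U_{l',J}`). [cite: GrauertRemmert1977, Kap. VI §4.3] -/
theorem memℓp_res_of_lt [T2Space M] [CompactSpace M] {l l' : Fin 4} (h : l < l') (a : ℕ)
    (g : (D.framedCover fr hfr l').Cochain a) :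
    Memℓp (D.repL fr hfr l a ((D.framedCover fr hfr l').res (D.U l) (D.isOpen l) (D.mono l l' h.le) a g)) ⊤ := by
  have hB : ∀ J : Fin (a + 1) → ↥D.s, ∃ B : ℝ, ∀ m ∈ closure (cechSet (D.U l) J), ‖(g J : M → ℂ) m‖ ≤ B := fun J ↦
    isClosed_closure.isCompact.exists_bound_of_continuousOn
      ((holFunOn.mdifferentiableOn (g J)).continuousOn.mono (D.closure_subset l l' h _ J))
  choose B hB using hB
  refine D.memℓp_of_forallL fr hfr (∑ J, max (B J) 0) fun J m hm ↦ ?_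
  rw [(D.framedCover fr hfr l').res_apply_apply_of_mem _ _ _ _ hm]
  exact ((hB J m (subset_closure hm)).trans (le_max_left _ _)).trans
    (Finset.single_le_sum (f := fun J ↦ max (B J) 0) (fun J _ ↦ le_max_right _ _) (Finset.mem_univ J))

/-! ### Restriction between the levels of the datum: syntactic forms -/

/-- Restriction between levels commutes with the twisted Čech differential (the levels of the datum
as framed covers; `FramedCover.res_delta`). [folklore] -/
theorem res_deltaD {l l' : Fin 4} (h : l ≤ l') (a : ℕ) (c : (D.framedCover fr hfr l').Cochain a) :
    (D.framedCover fr hfr l').res (D.U l) (D.isOpen l) (D.mono l l' h) (a + 1) ((D.framedCover fr hfr l').delta a c) =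
      (D.framedCover fr hfr l).delta a ((D.framedCover fr hfr l').res (D.U l) (D.isOpen l) (D.mono l l' h) a c) :=
  (D.framedCover fr hfr l').res_delta _ _ _ a c

/-- The degree-`0` case of `res_deltaD`, with the literal degree `1` (for rewriting). [folklore] -/
theorem res_delta_zeroD {l l' : Fin 4} (h : l ≤ l') (c : (D.framedCover fr hfr l').Cochain 0) :
    (D.framedCover fr hfr l').res (D.U l) (D.isOpen l) (D.mono l l' h) 1 ((D.framedCover fr hfr l').delta 0 c) =
      (D.framedCover fr hfr l).delta 0 ((D.framedCover fr hfr l').res (D.U l) (D.isOpen l) (D.mono l l' h) 0 c) :=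
  (D.framedCover fr hfr l').res_delta _ _ _ 0 c

/-- Restriction between levels is transitive (`FramedCover.res_res`). [folklore] -/
theorem res_resD {l l' l'' : Fin 4} (h : l ≤ l') (h' : l' ≤ l'') (a : ℕ) (c : (D.framedCover fr hfr l'').Cochain a) :
    (D.framedCover fr hfr l').res (D.U l) (D.isOpen l) (D.mono l l' h) a
        ((D.framedCover fr hfr l'').res (D.U l') (D.isOpen l') (D.mono l' l'' h') a c) =
      (D.framedCover fr hfr l'').res (D.U l) (D.isOpen l) (D.mono l l'' (h.trans h')) a c :=
  (D.framedCover fr hfr l'').res_res _ _ _ _ a c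

/-! ### Bounded cocycles and the restricted operators -/

section Spaces

variable [T2Space M] [CompactSpace M]

/-- **The bounded `a`-cocycles of `𝒪(L)` of level `l`**: the kernel of the bounded twisted Čech
differential (the higher level `l'` only witnesses boundedness of `δ`). [cite: GrauertRemmert1977, Kap. VI §4.3] -/
def ZbL {l l' : Fin 4} (h : l < l') (a : ℕ) : Submodule ℂ (D.BddL fr hfr l a) :=
  LinearMap.ker (D.deltaL fr hfr h a).toLinearMap

/-- Membership in the bounded cocycles. [folklore] -/
theorem mem_ZbL_iff {l l' : Fin 4} {h : l < l'} {a : ℕ} {c : D.BddL fr hfr l a} :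
    c ∈ D.ZbL fr hfr h a ↔ (D.framedCover fr hfr l).delta a c.val = 0 := by
  rw [ZbL, LinearMap.mem_ker]
  constructor
  · intro hc
    have h' := congrArg BddL.val hc
    rwa [ContinuousLinearMap.coe_coe, val_deltaL, BddL.val_zero] at h'
  · intro hc
    apply BddL.ext
    rw [ContinuousLinearMap.coe_coe, val_deltaL, BddL.val_zero]
    exact hc

/-- The bounded cocycles form a closed subspace. [folklore] -/
theorem isClosed_ZbL {l l' : Fin 4} (h : l < l') (a : ℕ) : IsClosed (D.ZbL fr hfr h a : Set (D.BddL fr hfr l a)) :=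
  (D.deltaL fr hfr h a).isClosed_ker

/-- The bounded cocycles form a Banach space. [cite: GrauertRemmert1977, Kap. VI §4.3] -/
instance instCompleteSpaceZbL [FiniteDimensional ℂ E] [IsManifold 𝓘(ℂ, E) ω M] {l l' : Fin 4} (h : l < l') (a : ℕ) :
    CompleteSpace ↥(D.ZbL fr hfr h a) :=
  (D.isClosed_ZbL fr hfr h a).completeSpace_coe

/-- **Restriction of bounded cocycles to a lower level.** [cite: GrauertRemmert1977, Kap. VI §4.3] -/
def resZL {l l' l'' : Fin 4} (h : l < l') (h' : l' < l'') (a : ℕ) : ↥(D.ZbL fr hfr h' a) →L[ℂ] ↥(D.ZbL fr hfr h a) :=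
  ((D.resL fr hfr h.le a).comp (D.ZbL fr hfr h' a).subtypeL).codRestrict (D.ZbL fr hfr h a) fun x ↦ by
    rw [mem_ZbL_iff]
    change (D.framedCover fr hfr l).delta a
      ((D.framedCover fr hfr l').res (D.U l) (D.isOpen l) (D.mono l l' h.le) a (x : D.BddL fr hfr l' a).val) = 0
    rw [← D.res_deltaD fr hfr h.le, (D.mem_ZbL_iff fr hfr).1 x.2]
    exact map_zero _

/-- Restriction of bounded cocycles on underlying bounded cochains. [folklore] -/
@[simp] theorem coe_resZL {l l' l'' : Fin 4} (h : l < l') (h' : l' < l'') {a : ℕ} (x : ↥(D.ZbL fr hfr h' a)) :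
    ((D.resZL fr hfr h h' a x : ↥(D.ZbL fr hfr h a)) : D.BddL fr hfr l a) = D.resL fr hfr h.le a (x : D.BddL fr hfr l' a) :=
  rfl

/-- **The bounded Čech differential into the bounded cocycles** (`δ ∘ δ = 0`).
[cite: GrauertRemmert1977, Kap. VI §4.3] -/
def deltaZL {l l' : Fin 4} (h : l < l') (k : ℕ) : D.BddL fr hfr l k →L[ℂ] ↥(D.ZbL fr hfr h (k + 1)) :=
  (D.deltaL fr hfr h k).codRestrict (D.ZbL fr hfr h (k + 1)) fun c ↦ by
    rw [mem_ZbL_iff, val_deltaL]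
    exact (D.framedCover fr hfr l).delta_delta k c.val

/-- The Čech differential into cocycles on underlying bounded cochains. [folklore] -/
@[simp] theorem coe_deltaZL {l l' : Fin 4} (h : l < l') {k : ℕ} (w : D.BddL fr hfr l k) :
    ((D.deltaZL fr hfr h k w : ↥(D.ZbL fr hfr h (k + 1))) : D.BddL fr hfr l (k + 1)) = D.deltaL fr hfr h k w :=
  rfl

/-- **Restriction of bounded cocycles to a strictly lower level is compact** (Montel, and the
cocycles are closed). [cite: GrauertRemmert1977, Kap. VI §4.2] -/
theorem isCompactOperator_resZL [FiniteDimensional ℂ E] [IsManifold 𝓘(ℂ, E) ω M] {l l' l'' : Fin 4}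
    (h : l < l') (h' : l' < l'') (a : ℕ) :
    IsCompactOperator (D.resZL fr hfr h h' a) := by
  refine isCompactOperator_of_subseq _ fun u hu ↦ ?_
  obtain ⟨c, φ, hφ, hc⟩ := D.exists_subseq_tendsto_resL fr hfr h a (fun n ↦ (u n : D.BddL fr hfr l' a)) fun n ↦ hu n
  have hcZ : c ∈ D.ZbL fr hfr h a :=
    (D.isClosed_ZbL fr hfr h a).mem_of_tendsto hc (Eventually.of_forall fun n ↦ (D.resZL fr hfr h h' a (u (φ n))).2)
  exact ⟨⟨c, hcZ⟩, φ, hφ, tendsto_subtype_rng.2 hc⟩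

/-- A bounded cocycle as an algebraic cocycle of its level. [folklore] -/
def toCocycleL {l l' : Fin 4} (h : l < l') (q : ℕ) :
    ↥(D.ZbL fr hfr h q) →ₗ[ℂ]
      ↥(NatCochain.cocycles (R := ℂ) (fun a ↦ (D.framedCover fr hfr l).delta a) q) where
  toFun y := ⟨(y : D.BddL fr hfr l q).val, (NatCochain.mem_cocycles_iff _).2 ((D.mem_ZbL_iff fr hfr).1 y.2)⟩
  map_add' _ _ := rfl
  map_smul' _ _ := rfl

/-- Underlying cochain of the algebraic cocycle of a bounded cocycle. [folklore] -/
@[simp] theorem coe_toCocycleL {l l' : Fin 4} (h : l < l') {q : ℕ} (y : ↥(D.ZbL fr hfr h q)) :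
    (D.toCocycleL fr hfr h q y : (D.framedCover fr hfr l).Cochain q) = (y : D.BddL fr hfr l q).val :=
  rfl

/-- **The cohomology class of a bounded cocycle of level `l`** in `H^q(𝔘_l, 𝒪(L))`.
[cite: GrauertRemmert1977, Kap. VI §4.3] -/
def clsL {l l' : Fin 4} (h : l < l') (q : ℕ) : ↥(D.ZbL fr hfr h q) →ₗ[ℂ] (D.framedCover fr hfr l).cohomology q :=
  (NatCochain.Cohomology.mk _ q) ∘ₗ D.toCocycleL fr hfr h q

/-- The class map, unfolded. [folklore] -/
theorem clsL_apply {l l' : Fin 4} (h : l < l') {q : ℕ} (y : ↥(D.ZbL fr hfr h q)) :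
    D.clsL fr hfr h q y = NatCochain.Cohomology.mk _ q (D.toCocycleL fr hfr h q y) :=
  rfl

/-- **Coboundaries of bounded cochains have zero class.** [cite: GrauertRemmert1977, Kap. VI §4.3] -/
theorem clsL_deltaZL {l l' : Fin 4} (h : l < l') (k : ℕ) (w : D.BddL fr hfr l k) :
    D.clsL fr hfr h (k + 1) (D.deltaZL fr hfr h k w) = 0 :=
  (NatCochain.Cohomology.mk_eq_zero_iff _ _).2 ((NatCochain.mem_coboundaries_succ_iff _).2 ⟨w.val, rfl⟩)

end Spaces

/-! ### The two Leray inputs -/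

section Leray

variable [FiniteDimensional ℂ E] [T2Space M] [CompactSpace M] [IsManifold 𝓘(ℂ, E) ω M] [IsManifold 𝓘(ℝ, E) ∞ M]

omit [FiniteDimensional ℂ E] [T2Space M] [CompactSpace M] [IsManifold 𝓘(ℂ, E) ω M] [IsManifold 𝓘(ℝ, E) ∞ M] in
/-- Every level covers `M`. [folklore] -/
theorem exists_mem_U (l : Fin 4) (x : M) : ∃ i, x ∈ D.U l i := by
  have hx : x ∈ ⋃ i, D.U l i := by rw [D.cover l]; exact mem_univ x
  exact mem_iUnion.1 hx

omit [CompactSpace M] in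
/-- **The members of every level are `∂̄`-acyclic in bidegrees `(0, ≥ 1)`** (chart-convex sets: the
`∂̄`-Poincaré lemma of the tree). [cite: VoisinHodgeI2002, Prop. 2.36] -/
theorem isDolbeaultAcyclic_U (l : Fin 4) (i : ↥D.s) : IsDolbeaultAcyclic E M (D.isOpen l i) 0 := by
  have e : D.U l i = chartSet 𝓘(ℝ, E) (D.ctr 0 ![i]) (D.C 0 ![i] l) := by
    rw [← D.cechSet_eq 0 ![i] l, cechSet_fin_one]
    rfl
  exact IsDolbeaultAcyclic.of_eq_chartSet 0 _ e (D.C_open 0 _ l) (D.C_convex 0 _ l) (D.C_subset 0 _ l)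

/-- **Leray input (i): every class of `H¹(𝔘₀, 𝒪(L))` is the class of a bounded cocycle restricted
from level `1`** (solve on the acyclic level `2` by the degree-one Leray lemma, then restrict: algebraic
restriction to a strictly lower level is bounded). [cite: GrauertRemmert1977, Kap. VI §4.3] -/
theorem exists_clsL_resZL_eq (c : (D.framedCover fr hfr 0).cohomology 1) :
    ∃ y : ↥(D.ZbL fr hfr (show (1 : Fin 4) < 2 by decide) 1),
      D.clsL fr hfr (show (0 : Fin 4) < 1 by decide) 1 (D.resZL fr hfr (show (0 : Fin 4) < 1 by decide)
        (show (1 : Fin 4) < 2 by decide) 1 y) = c := by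
  have h01 : (0 : Fin 4) < 1 := by decide
  have h12 : (1 : Fin 4) < 2 := by decide
  have h02 : (0 : Fin 4) ≤ 2 := by decide
  obtain ⟨z, rfl⟩ := NatCochain.Cohomology.mk_surjective (R := ℂ) (fun a ↦ (D.framedCover fr hfr 0).delta a) 1 c
  have hz : (D.framedCover fr hfr 0).delta 1 (z : (D.framedCover fr hfr 0).Cochain 1) = 0 :=
    (NatCochain.mem_cocycles_iff _).1 z.2
  -- the degree-one Leray lemma on the acyclic level `2`, shrunk to level `0`
  obtain ⟨x', w', hx', hres⟩ := (D.framedCover fr hfr 2).exists_cocycle_res_eq_add_delta (D.U 0) (D.isOpen 0)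
    (D.mono 0 2 h02) (D.exists_mem_U 0) (D.isDolbeaultAcyclic_U 2) (z : (D.framedCover fr hfr 0).Cochain 1) hz
  -- `y = x'|₁`, bounded
  have hres' : (D.framedCover fr hfr 2).res (D.U 0) (D.isOpen 0) (D.mono 0 2 h02) 1 x' =
      (z : (D.framedCover fr hfr 0).Cochain 1) + (D.framedCover fr hfr 0).delta 0 w' := hres
  have hyZ : (⟨_, D.memℓp_res_of_lt fr hfr h12 1 x'⟩ : D.BddL fr hfr 1 1) ∈ D.ZbL fr hfr h12 1 := by
    rw [mem_ZbL_iff, BddL.val_mk, ← D.res_deltaD fr hfr h12.le, hx']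
    exact map_zero _
  refine ⟨⟨_, hyZ⟩, ?_⟩
  rw [clsL_apply]
  refine (NatCochain.Cohomology.mk_eq_mk_iff _ _ _).2 ((NatCochain.mem_coboundaries_succ_iff _).2 ⟨w', ?_⟩)
  rw [coe_toCocycleL, coe_resZL, val_resL, BddL.val_mk, D.res_resD fr hfr h01.le h12.le, hres', add_sub_cancel_left]

/-- **Leray input (ii): controlled solvability** — for a bounded `1`-cocycle `y` of level `1` there
are a bounded `1`-cocycle `x` of level `2` and a bounded `0`-cochain `w` of level `0` with
`res res x = res y + δ w` on level `0` (solve on the acyclic level `3` by the degree-one Leray lemma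
shrunk to level `1`: `x'|₁ = y + δ w'`; restrict `x'` to level `2` and `w'` to level `0`, where they
are bounded). [cite: GrauertRemmert1977, Kap. VI §4.3] -/
theorem exists_resZL_resZL_eq_add_deltaZL (y : ↥(D.ZbL fr hfr (show (1 : Fin 4) < 2 by decide) 1)) :
    ∃ (x : ↥(D.ZbL fr hfr (show (2 : Fin 4) < 3 by decide) 1)) (w : D.BddL fr hfr 0 0),
      D.resZL fr hfr (show (0 : Fin 4) < 1 by decide) (show (1 : Fin 4) < 2 by decide) 1
          (D.resZL fr hfr (show (1 : Fin 4) < 2 by decide) (show (2 : Fin 4) < 3 by decide) 1 x) =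
        D.resZL fr hfr (show (0 : Fin 4) < 1 by decide) (show (1 : Fin 4) < 2 by decide) 1 y +
          D.deltaZL fr hfr (show (0 : Fin 4) < 1 by decide) 0 w := by
  have h01 : (0 : Fin 4) < 1 := by decide
  have h12 : (1 : Fin 4) < 2 := by decide
  have h23 : (2 : Fin 4) < 3 := by decide
  have h13 : (1 : Fin 4) ≤ 3 := by decide
  have hy : (D.framedCover fr hfr 1).delta 1 (y : D.BddL fr hfr 1 1).val = 0 := (D.mem_ZbL_iff fr hfr).1 y.2
  -- the degree-one Leray lemma on the acyclic level `3`, shrunk to level `1`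
  obtain ⟨x', w', hx', hres⟩ := (D.framedCover fr hfr 3).exists_cocycle_res_eq_add_delta (D.U 1) (D.isOpen 1)
    (D.mono 1 3 h13) (D.exists_mem_U 1) (D.isDolbeaultAcyclic_U 3) (y : D.BddL fr hfr 1 1).val hy
  have hres' : (D.framedCover fr hfr 3).res (D.U 1) (D.isOpen 1) (D.mono 1 3 h13) 1 x' =
      (y : D.BddL fr hfr 1 1).val + (D.framedCover fr hfr 1).delta 0 w' := hres
  have hxZ : (⟨_, D.memℓp_res_of_lt fr hfr h23 1 x'⟩ : D.BddL fr hfr 2 1) ∈ D.ZbL fr hfr h23 1 := by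
    rw [mem_ZbL_iff, BddL.val_mk, ← D.res_deltaD fr hfr h23.le, hx']
    exact map_zero _
  refine ⟨⟨_, hxZ⟩, ⟨_, D.memℓp_res_of_lt fr hfr h01 0 w'⟩, ?_⟩
  apply Subtype.ext
  apply BddL.ext
  rw [Submodule.coe_add, BddL.val_add, coe_resZL, coe_resZL, coe_deltaZL, val_resL, val_resL, val_deltaL,
    coe_resZL, val_resL, BddL.val_mk, BddL.val_mk, D.res_resD fr hfr h12.le h23.le, D.res_resD fr hfr h01.le h13,
    ← D.res_delta_zeroD fr hfr h01.le]
  exact ((D.res_resD fr hfr h01.le h13 1 x').symm.trans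
    ((congrArg ((D.framedCover fr hfr 1).res (D.U 0) (D.isOpen 0) (D.mono 0 1 h01.le) 1) hres').trans
      (map_add _ _ _)))

/-! ### The finiteness theorem -/

/-- **The Cartan–Serre finiteness theorem for `𝒪(L)` in degree one**: for a cocycle line bundle `L`
on a compact complex manifold and nested Leray data subordinate to its trivialisation, the Čech
cohomology `H¹(𝔘₀, 𝒪(L))` of the level-`0` cover with coefficients in the sheaf of sections of `L`
is finite-dimensional (H. Cartan, J.-P. Serre (1953); Grauert–Remmert (1977), Kap. VI §4
Endlichkeitssatz; Forster (1981), Thm. 14.9 — via L. Schwartz's theorem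
`Module.finite_of_compact_restriction`). [cite: CartanSerre1953] -/
theorem finite_cohomology_oneL : Module.Finite ℂ ((D.framedCover fr hfr 0).cohomology 1) := by
  have h01 : (0 : Fin 4) < 1 := by decide
  have h12 : (1 : Fin 4) < 2 := by decide
  have h23 : (2 : Fin 4) < 3 := by decide
  exact Module.finite_of_compact_restriction (D.resZL fr hfr h12 h23 1) (D.resZL fr hfr h01 h12 1)
    (D.deltaZL fr hfr h01 0) (D.isCompactOperator_resZL fr hfr h12 h23 1)
    (D.exists_resZL_resZL_eq_add_deltaZL fr hfr) (D.clsL fr hfr h01 1) (D.clsL_deltaZL fr hfr h01 0)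
    (D.exists_clsL_resZL_eq fr hfr)

end Leray

end DolbeaultLerayDatum

end Literature.Geometry.Kaehler
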